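/-
Copyright (c) 2026 the pub-hodgecm-mathlib formalisation cell (harness21).  Prover seat hodgecm-mathlib-K2Liu-p01 (g8), Track B «K2-LIT»,
#184♮ = hLiu418 = `stmt-HodgeConjecture-24832`; #42S organ S1 ROAD W, F7 `K2LiuLocalSWParityOscillation` ∕ F7r ∕ F8 (RULINGS «M-158a» (2), «M-158b»); organ lead
K2Liu-p06 (g4) SPEC-S1-AssemblySocket §2 row `hsum`; my CENSUS-F7-ProfileSumTransport (d5aeea8ad1f9d314) file (T3-frame-i-a): the set `D = {x : ∀ t ∈ 𝔰_Λ, ψ_v(⟪t,x⟫) = 1}`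
of ★ (T1) read through the CONDUCTOR BALL of `ψ_v` (generic non-archimedean local field bookkeeping).
-/
import Literature.NumberTheory.Automorphic.AddCharConductorExponent   -- ★ `primePowBall`, `normAbs`, `AddChar.HasConductorExp`, `exists_normAbs_eq_inv_zpow`, `mul_mem_primePowBall_iff`
import HarnessLib

/-!
# Crux `HLiu418`, #42S-S1 ROAD W, file (T3-frame-i-a): AN ADDITIVE CHARACTER OF CONDUCTOR EXPONENT `m` IS TRIVIAL ON AN `𝒪`-STABLE SET IFF THE SET LIES IN `𝔭^m`
# (hence «`ψ(c · ℓ(t)) = 1` for all `t` of an `𝒪`-box `S`» ↔ «`ℓ(S) ⊆ 𝔭^{m − k}`», `‖c‖ = q^{−k}`)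

Cell `hodgecm-mathlib`, crux item hLiu418 = `stmt-HodgeConjecture-24832` (helper lane `--supports … --as helper`, count-neutral).  THEOREMS ONLY (no `def`, no instance,
no notation, no named-fact hypothesis, no `sorry`).  GENERIC over any non-archimedean local field `F` (the tree's `IsNonarchimedeanLocalField` + `normAbs` + `primePowBall`
currency of ★ `TateLocalFactors` ∕ ★ `AddCharConductorExponent`); serves F7 ∕ F7r ∕ F8 alike.

THE SITUATION.  ★ (T1) `K2LiuProfileSumCharacterOrthogonality` leaves the profile sum as `|𝔰_Λ ⧸ 𝔰_{Λ₀}| · ∫ 𝟙_D φ` with `D = {x : ∀ t ∈ 𝔰_Λ, e(t, x) = 1}` and (★ (T3a)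
`K2LiuSiegelUnipotentPairingGram`) `e(t, x) = ψ_v(c · ℓ_x(t))`, `ℓ_x` `F_v`-LINEAR in `t` (`ℓ_x(t) = im tr(𝕋₀ · t · G(x))`), `c = −½·2 = −1` or any fixed scalar; `𝔰_Λ` is an
`𝒪_v`-box (stable under multiplication by integers of `F_v`).  Then `ℓ_x(𝔰_Λ)` is an `𝒪_v`-stable subset of `F_v`, and:
* §1 `le_normAbs_of_not_mem_primePowBall` (off `𝔭^m` means norm `≥ q^{−(m−1)}`, discreteness of `‖·‖`); **`forall_eq_one_iff_subset_primePowBall`** — for `ψ` of conductor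
  exponent `m` (★ `AddChar.HasConductorExp`: trivial on `𝔭^m`, not on `𝔭^{m−1}`) and an `𝒪`-stable `N ⊆ F`: `(∀ y ∈ N, ψ y = 1) ↔ N ⊆ 𝔭^m` (if `y₀ ∈ N ∖ 𝔭^m` and `ψ x₀ ≠ 1`,
  `x₀ ∈ 𝔭^{m−1}`, then `x₀ = (x₀∕y₀)·y₀ ∈ N` since `‖x₀∕y₀‖ ≤ 1`).
* §2 the LINEAR-IMAGE forms the witness files consume: **`forall_eq_one_comp_iff`** (`(∀ t ∈ S, ψ (ℓ t) = 1) ↔ ∀ t ∈ S, ℓ t ∈ 𝔭^m` for an additive `ℓ` with `ℓ(a • t) = a · ℓ t`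
  and an `𝒪`-stable `S`), **`forall_eq_one_const_mul_comp_iff`** (with a scalar `c`, `‖c‖ = q^{−k}`: `… ↔ ∀ t ∈ S, ℓ t ∈ 𝔭^{m−k}`, ★ `mul_mem_primePowBall_iff`).
[Tate1950, §2.2 (the conductor of a character; `𝔭^m`-periodicity)] [BushnellHenniart2006, §1.7] [Weil1964, n° 13].
HONEST LABEL.  Count-neutral helper; `HC_CM` is proved only modulo the 7 printed citations (2 remaining named inputs: hLiu418 = `stmt-HodgeConjecture-24832`,
h413 = `stmt-HodgeConjecture-24833`) until rung 0 closes.  NOT here: the identification `ℓ_x(𝔰_{Λ₀}) ⊆ 𝔭^{m′} ↔ G(x) ∈ Λ₀^⊥` (trace-form duality of `Herm_n(𝒪_E)`, (T3-frame-i-c)).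

## References
* [Tate1950] J. Tate, *Fourier analysis in number fields and Hecke's zeta-functions* (1950), §2.2.
* [BushnellHenniart2006] C. J. Bushnell, G. Henniart, *The local Langlands conjecture for GL(2)*, Grundlehren 335 (2006), §1.7.
* [Weil1964] A. Weil, *Sur certains groupes d'opérateurs unitaires*, Acta Math. 111 (1964), n° 13.
-/

set_option autoImplicit false
set_option linter.dupNamespace false -- the mandated namespace repeats `HodgeConjecture.HodgeConjecture`

noncomputable section

open scoped NNReal
open Literature.NumberTheory.Automorphic Literature.NumberTheory.GaloisRepresentations.IsNonarchimedeanLocalField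

namespace Summit.HodgeConjecture.HodgeConjecture.Cruxes.HLiu418.K2LiuAddCharTrivialOnLattice

variable {F : Type*} [Field F] [ValuativeRel F] [TopologicalSpace F] [IsNonarchimedeanLocalField F]

/-! ## §1 Trivial on an `𝒪`-stable set iff inside the conductor ball -/

/-- off the ball `𝔭^m` the norm is at least `q^{−(m−1)}` (the value group is `q^ℤ`). [cite: Tate1950, §2.2] -/
theorem le_normAbs_of_not_mem_primePowBall {m : ℤ} {y : F} (hy : y ∉ primePowBall F m) :
    (residueFieldCard F : ℝ≥0)⁻¹ ^ (m - 1) ≤ normAbs F y := by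
  have hy0 : y ≠ 0 := fun h => hy (h ▸ zero_mem_primePowBall m)
  obtain ⟨k, hk⟩ := exists_normAbs_eq_inv_zpow hy0
  rw [mem_primePowBall_iff, hk, not_le] at hy
  rw [hk]
  -- `(q⁻¹)^m < (q⁻¹)^k` with `q⁻¹ < 1` forces `k < m`, i.e. `k ≤ m − 1`
  have hkm : k < m := (zpow_lt_zpow_iff_right_of_lt_one₀ inv_residueFieldCard_pos inv_residueFieldCard_lt_one).1 hy
  exact zpow_le_zpow_right_of_le_one₀ inv_residueFieldCard_pos inv_residueFieldCard_lt_one.le (by omega)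

/-- **TRIVIAL ON AN `𝒪`-STABLE SET IFF INSIDE `𝔭^m`.**  For `ψ` of conductor exponent `m` and `N ⊆ F` stable under multiplication by integers (`‖a‖ ≤ 1`):
`(∀ y ∈ N, ψ y = 1) ↔ N ⊆ 𝔭^m`. [cite: Tate1950, §2.2] [cite: BushnellHenniart2006, §1.7] -/
theorem forall_eq_one_iff_subset_primePowBall {ψ : AddChar F Circle} {m : ℤ} (hψ : ψ.HasConductorExp m) {N : Set F}
    (hN : ∀ a : F, normAbs F a ≤ 1 → ∀ y ∈ N, a * y ∈ N) :
    (∀ y ∈ N, ψ y = 1) ↔ N ⊆ primePowBall F m := by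
  refine ⟨fun h y hy => ?_, fun h y hy => hψ.1 y (h hy)⟩
  by_contra hym
  obtain ⟨x₀, hx₀, hψx₀⟩ := hψ.2
  have hy0 : y ≠ 0 := fun h0 => hym (h0 ▸ zero_mem_primePowBall m)
  have hny : normAbs F y ≠ 0 := fun h0 => hy0 ((map_eq_zero (normAbs F)).1 h0)
  -- `a = x₀ / y` is an integer
  have ha : normAbs F (x₀ / y) ≤ 1 := by
    rw [map_div₀, div_le_one (pos_iff_ne_zero.2 hny)]
    exact (mem_primePowBall_iff.1 hx₀).trans (le_normAbs_of_not_mem_primePowBall hym)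
  have hmem : x₀ / y * y ∈ N := hN _ ha y hy
  rw [div_mul_cancel₀ x₀ hy0] at hmem
  exact hψx₀ (h x₀ hmem)

/-! ## §2 Linear images of `𝒪`-boxes -/

/-- the image of an `𝒪`-stable set under a map with `ℓ (a • t) = a * ℓ t` is `𝒪`-stable. [folklore] -/
theorem image_stable {T : Type*} [SMul F T] (ℓ : T → F) (hℓ : ∀ (a : F) (t : T), ℓ (a • t) = a * ℓ t) {S : Set T}
    (hS : ∀ a : F, normAbs F a ≤ 1 → ∀ t ∈ S, a • t ∈ S) :
    ∀ a : F, normAbs F a ≤ 1 → ∀ y ∈ ℓ '' S, a * y ∈ ℓ '' S := by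
  rintro a ha y ⟨t, ht, rfl⟩
  exact ⟨a • t, hS a ha t ht, hℓ a t⟩

/-- **LINEAR-IMAGE FORM**: for `ℓ` with `ℓ(a • t) = a·ℓ(t)` and an `𝒪`-stable box `S`, `(∀ t ∈ S, ψ (ℓ t) = 1) ↔ ∀ t ∈ S, ℓ t ∈ 𝔭^m`.
[cite: Tate1950, §2.2] [cite: Weil1964, n° 13] -/
theorem forall_eq_one_comp_iff {ψ : AddChar F Circle} {m : ℤ} (hψ : ψ.HasConductorExp m) {T : Type*} [SMul F T] (ℓ : T → F)
    (hℓ : ∀ (a : F) (t : T), ℓ (a • t) = a * ℓ t) {S : Set T} (hS : ∀ a : F, normAbs F a ≤ 1 → ∀ t ∈ S, a • t ∈ S) :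
    (∀ t ∈ S, ψ (ℓ t) = 1) ↔ ∀ t ∈ S, ℓ t ∈ primePowBall F m := by
  have h := forall_eq_one_iff_subset_primePowBall hψ (image_stable ℓ hℓ hS)
  constructor
  · intro H t ht
    refine h.1 (fun y hy => ?_) ⟨t, ht, rfl⟩
    obtain ⟨t', ht', rfl⟩ := hy
    exact H t' ht'
  · intro H t ht
    exact hψ.1 _ (H t ht)

/-- **… WITH A SCALAR**: `(∀ t ∈ S, ψ (c · ℓ t) = 1) ↔ ∀ t ∈ S, ℓ t ∈ 𝔭^{m − k}` when `‖c‖ = q^{−k}` (e.g. `c = −1`, `k = 0`; `c = −½` at a dyadic place, `k = −v(2)`).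
[cite: Tate1950, §2.2] [cite: Weil1964, n° 13] -/
theorem forall_eq_one_const_mul_comp_iff {ψ : AddChar F Circle} {m : ℤ} (hψ : ψ.HasConductorExp m) {T : Type*} [SMul F T] (ℓ : T → F)
    (hℓ : ∀ (a : F) (t : T), ℓ (a • t) = a * ℓ t) {S : Set T} (hS : ∀ a : F, normAbs F a ≤ 1 → ∀ t ∈ S, a • t ∈ S)
    {c : F} {k : ℤ} (hc : normAbs F c = (residueFieldCard F : ℝ≥0)⁻¹ ^ k) :
    (∀ t ∈ S, ψ (c * ℓ t) = 1) ↔ ∀ t ∈ S, ℓ t ∈ primePowBall F (m - k) := by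
  have h := forall_eq_one_comp_iff hψ (fun t => c * ℓ t) (fun a t => by rw [hℓ, mul_left_comm]) hS
  rw [h]
  refine forall₂_congr fun t _ => ?_
  exact mul_mem_primePowBall_iff hc

/-- the case `c = −1` (`‖−1‖ = 1 = q^0`): `(∀ t ∈ S, ψ (−ℓ t) = 1) ↔ ∀ t ∈ S, ℓ t ∈ 𝔭^m`. [cite: Tate1950, §2.2] -/
theorem forall_eq_one_neg_comp_iff {ψ : AddChar F Circle} {m : ℤ} (hψ : ψ.HasConductorExp m) {T : Type*} [SMul F T] (ℓ : T → F)
    (hℓ : ∀ (a : F) (t : T), ℓ (a • t) = a * ℓ t) {S : Set T} (hS : ∀ a : F, normAbs F a ≤ 1 → ∀ t ∈ S, a • t ∈ S) :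
    (∀ t ∈ S, ψ (-ℓ t) = 1) ↔ ∀ t ∈ S, ℓ t ∈ primePowBall F m := by
  have h := forall_eq_one_const_mul_comp_iff hψ ℓ hℓ hS (c := -1) (k := 0) (by rw [normAbs_neg, map_one, zpow_zero])
  simp only [neg_mul, one_mul, sub_zero] at h
  exact h

end Summit.HodgeConjecture.HodgeConjecture.Cruxes.HLiu418.K2LiuAddCharTrivialOnLattice

end
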